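/-
Copyright: the b2b-balaban T⁴-continuum CRUX team, row NE7b OWNER lineage `t4-ne7b-p1` (gen 143). Project licence.
-/
import Summits.QuantumFields.BalabanUV.T4Continuum.Spine.NE7b.SupTiltedCentredSplits

/-!
# THE TILTED CUMULANT CALCULUS, RULE THREE (SCOPING (d15)): along `ψ_s = ψ₀ + s·n`, for abstract growth-class observables `p, q, r`,
#   RULE 3  `d∕ds κ₃ᶜ(p,q,r) = κ₃ᶜ(∂p,q,r) + κ₃ᶜ(p,∂q,r) + κ₃ᶜ(p,q,∂r) − u₄(p,q,r,A)`,
# `κ₃ᶜ` the CENTRED third cumulant `Z⁻¹∫e(p−⟨p⟩)(q−⟨q⟩)(r−⟨r⟩)` (the background-dependent centring INSIDE the integrand, as in (521)'s display),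
# `u₄` in (522)∕(572)'s format (the centred fourth moment minus the three products of centred pair moments), `A = U′(·)n`, `∂p = p′(·)n`.  Proof
# recipe of (581): the centred function equals the RAW `Z⁻¹∫epqr − Z⁻²Σ∫ep∫eqr + 2Z⁻³∫ep∫eq∫er` for every `s` ((581) `split_centred_triple`, `Z > 0`),
# whose eight moments have line derivatives by (581) `hasDerivAt_moment_line` and the class closure; the target is split into raw moments by
# `split_centred_pair∕triple∕quad`; `field_simp; ring` closes (row NE7b, node U5c; (581), (582) BY NAME; [folklore])

Cell `pub-balaban`, sub-cell `t4`, spine estimate NE7b (`T4WeightBudget.RelWeightBound`; the cell's OWN estimate — NOT PRINTED in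
[Bałaban 1983–89], NOT PROVED).  Crux-route work under `Spine/NE7b/` by the row OWNER (`t4-ne7b-p1` gen 143, file (583)) under FREEZE
(0)'s crux-prover clause; NOTHING of Bałaban's is named as a Lean object, valued or asserted; no `T4Continuum/Support` leaf typed; no
`def`, no notation; zero `sorry`.  Imports (BY NAME): the OWNER's (582) `…SupTiltedCentredSplits` (`split_centred_pair`, `split_centred_quad`),
(581) `…SupTiltedCumulantCalculusOne` (everything else; through it (513), (518), (516), (514), (410)).

WHAT IS PROVED ([folklore]): **RULE 3 `hasDerivAt_tilted_kappa3_line`**; toy.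

HONEST (what this is NOT).  Calculus bookkeeping; rule 4 (`u₄ ↦ Σu₄(∂) − u₅`), the fifteen instantiations, the FORM of `∂⁵W` and the assembly are NOT
typed here.  Scalar skeleton ((A3), NC-NE7b-α UNRULED); nothing of Bałaban's asserted.  BY-NAME EFFECT ON THE WALL: NONE.  NE7b NOT PRINTED ∕
NOT PROVED; spine PROVED 0∕9; rung (B)+1 — the programme's measures remain FINITE-torus statements; NOT the mass gap, NOT Clay.  HONEST DEPENDENCY:
continuum YM on T⁴ ⇐ BetaPertH ∧ nine spine estimates (0∕9 proved); BetaPertH ⇐ (D1) ∧ (D4) ∧ CAP+tail; G-an2-4 gates asym, D1 and NE2∕3∕4.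
-/

set_option autoImplicit false
set_option maxSynthPendingDepth 3

noncomputable section

namespace Summit.QuantumFields.BalabanUV.T4Continuum.NE7b.SupTiltedCumulantCalculusTwo

open MeasureTheory ProbabilityTheory Real Set Function Finset Matrix
open scoped BigOperators
open SupFourthOrderMonomials (integrable_tilted_of_growth)
open SupBlockDressedStep (block_Z_pos)
open SupTiltedCumulantCalculusOne (class_const_nonneg class_mul_abs_le class_mul_fderiv_le class_mul_fderiv_continuous class_grad_abs_le
  class_apply_abs_le hasDerivAt_moment_line hasDerivAt_Z_line split_centred_triple)
open SupTiltedCentredSplits (split_centred_pair split_centred_quad)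

variable {ι : Type} [Fintype ι] [DecidableEq ι]

variable {Γ : Matrix ι ι ℝ} {γop : ℝ} {U : EuclideanSpace ℝ ι → ℝ} {U' : EuclideanSpace ℝ ι → EuclideanSpace ℝ ι →L[ℝ] ℝ}
  {U'' : EuclideanSpace ℝ ι → EuclideanSpace ℝ ι →L[ℝ] EuclideanSpace ℝ ι →L[ℝ] ℝ} {κ₀ κ₁ κ₂ a τ δ θ : ℝ}
  {p q r : EuclideanSpace ℝ ι → ℝ} {p' q' r' : EuclideanSpace ℝ ι → EuclideanSpace ℝ ι →L[ℝ] ℝ} {Cp Cq Cr : ℝ} {np nq nr : ℕ}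

/-! ## RULE 3: the centred third cumulant -/

set_option maxHeartbeats 800000 in
/-- **RULE 3 — `d∕ds κ₃ᶜ(p,q,r) = κ₃ᶜ(∂p,q,r) + κ₃ᶜ(p,∂q,r) + κ₃ᶜ(p,q,∂r) − u₄(p,q,r,A)`** along `ψ_s = ψ₀ + s·n`. [folklore] -/
theorem hasDerivAt_tilted_kappa3_line (hΓ : Γ.PosSemidef) (hΓop : (γop • (1 : Matrix ι ι ℝ) - Γ).PosSemidef) (Y : Finset ι)
    (hUd : ∀ φ : EuclideanSpace ℝ ι, HasFDerivAt U (U' φ) φ) (hU'd : ∀ φ : EuclideanSpace ℝ ι, HasFDerivAt U' (U'' φ) φ)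
    (hκ₀ : 0 ≤ κ₀) (hκ₁ : 0 ≤ κ₁) (ha : 0 ≤ a) (hτ : 0 < τ) (hδ : 0 < δ) (hθ0 : 0 < θ) (hθ1 : θ < 1) (hκθ : (2 * κ₀ * (1 + τ) + 4 * δ) * γop ≤ θ)
    (hstab : ∀ φ : EuclideanSpace ℝ ι, -(κ₀ * ∑ x ∈ Y, φ x ^ 2) ≤ U φ) (hU'b : ∀ φ : EuclideanSpace ℝ ι, ‖U' φ‖ ≤ κ₁ * (a + ∑ x ∈ Y, φ x ^ 2))
    (hU''b : ∀ φ : EuclideanSpace ℝ ι, ‖U'' φ‖ ≤ κ₂)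
    (hp : ∀ φ : EuclideanSpace ℝ ι, HasFDerivAt p (p' φ) φ) (hp'c : Continuous p') (hpb : ∀ φ : EuclideanSpace ℝ ι, |p φ| ≤ Cp * (1 + ‖U' φ‖) ^ np)
    (hp'b : ∀ φ : EuclideanSpace ℝ ι, ‖p' φ‖ ≤ Cp * (1 + ‖U' φ‖) ^ np)
    (hq : ∀ φ : EuclideanSpace ℝ ι, HasFDerivAt q (q' φ) φ) (hq'c : Continuous q') (hqb : ∀ φ : EuclideanSpace ℝ ι, |q φ| ≤ Cq * (1 + ‖U' φ‖) ^ nq)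
    (hq'b : ∀ φ : EuclideanSpace ℝ ι, ‖q' φ‖ ≤ Cq * (1 + ‖U' φ‖) ^ nq)
    (hr : ∀ φ : EuclideanSpace ℝ ι, HasFDerivAt r (r' φ) φ) (hr'c : Continuous r') (hrb : ∀ φ : EuclideanSpace ℝ ι, |r φ| ≤ Cr * (1 + ‖U' φ‖) ^ nr)
    (hr'b : ∀ φ : EuclideanSpace ℝ ι, ‖r' φ‖ ≤ Cr * (1 + ‖U' φ‖) ^ nr) (ψ₀ n : EuclideanSpace ℝ ι) :
    HasDerivAt (fun s : ℝ => ((∫ ω : EuclideanSpace ℝ ι, exp (-U (ω + (ψ₀ + s • n))) ∂(multivariateGaussian 0 Γ))⁻¹ * (∫ ω : EuclideanSpace ℝ ι, exp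
        (-U (ω + (ψ₀ + s • n))) * ((p (ω + (ψ₀ + s • n)) - ((∫ ω : EuclideanSpace ℝ ι, exp (-U (ω + (ψ₀ + s • n))) ∂(multivariateGaussian 0 Γ))⁻¹ *
        (∫ ω : EuclideanSpace ℝ ι, exp (-U (ω + (ψ₀ + s • n))) * p (ω + (ψ₀ + s • n)) ∂(multivariateGaussian 0 Γ)))) * (q (ω + (ψ₀ + s • n)) - ((∫ ω
        : EuclideanSpace ℝ ι, exp (-U (ω + (ψ₀ + s • n))) ∂(multivariateGaussian 0 Γ))⁻¹ * (∫ ω : EuclideanSpace ℝ ι, exp (-U (ω + (ψ₀ + s • n))) * q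
        (ω + (ψ₀ + s • n)) ∂(multivariateGaussian 0 Γ)))) * (r (ω + (ψ₀ + s • n)) - ((∫ ω : EuclideanSpace ℝ ι, exp (-U (ω + (ψ₀ + s • n)))
        ∂(multivariateGaussian 0 Γ))⁻¹ * (∫ ω : EuclideanSpace ℝ ι, exp (-U (ω + (ψ₀ + s • n))) * r (ω + (ψ₀ + s • n)) ∂(multivariateGaussian 0
        Γ))))) ∂(multivariateGaussian 0 Γ))))
      (((∫ ω : EuclideanSpace ℝ ι, exp (-U (ω + ψ₀)) ∂(multivariateGaussian 0 Γ))⁻¹ * (∫ ω : EuclideanSpace ℝ ι, exp (-U (ω + ψ₀)) * ((p' (ω + ψ₀) n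
          - ((∫ ω : EuclideanSpace ℝ ι, exp (-U (ω + ψ₀)) ∂(multivariateGaussian 0 Γ))⁻¹ * (∫ ω : EuclideanSpace ℝ ι, exp (-U (ω + ψ₀)) * p' (ω + ψ₀)
          n ∂(multivariateGaussian 0 Γ)))) * (q (ω + ψ₀) - ((∫ ω : EuclideanSpace ℝ ι, exp (-U (ω + ψ₀)) ∂(multivariateGaussian 0 Γ))⁻¹ * (∫ ω :
          EuclideanSpace ℝ ι, exp (-U (ω + ψ₀)) * q (ω + ψ₀) ∂(multivariateGaussian 0 Γ)))) * (r (ω + ψ₀) - ((∫ ω : EuclideanSpace ℝ ι, exp (-U (ω +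
          ψ₀)) ∂(multivariateGaussian 0 Γ))⁻¹ * (∫ ω : EuclideanSpace ℝ ι, exp (-U (ω + ψ₀)) * r (ω + ψ₀) ∂(multivariateGaussian 0 Γ)))))
          ∂(multivariateGaussian 0 Γ))) +
        ((∫ ω : EuclideanSpace ℝ ι, exp (-U (ω + ψ₀)) ∂(multivariateGaussian 0 Γ))⁻¹ * (∫ ω : EuclideanSpace ℝ ι, exp (-U (ω + ψ₀)) * ((p (ω + ψ₀) -
            ((∫ ω : EuclideanSpace ℝ ι, exp (-U (ω + ψ₀)) ∂(multivariateGaussian 0 Γ))⁻¹ * (∫ ω : EuclideanSpace ℝ ι, exp (-U (ω + ψ₀)) * p (ω + ψ₀)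
            ∂(multivariateGaussian 0 Γ)))) * (q' (ω + ψ₀) n - ((∫ ω : EuclideanSpace ℝ ι, exp (-U (ω + ψ₀)) ∂(multivariateGaussian 0 Γ))⁻¹ * (∫ ω :
            EuclideanSpace ℝ ι, exp (-U (ω + ψ₀)) * q' (ω + ψ₀) n ∂(multivariateGaussian 0 Γ)))) * (r (ω + ψ₀) - ((∫ ω : EuclideanSpace ℝ ι, exp (-U
            (ω + ψ₀)) ∂(multivariateGaussian 0 Γ))⁻¹ * (∫ ω : EuclideanSpace ℝ ι, exp (-U (ω + ψ₀)) * r (ω + ψ₀) ∂(multivariateGaussian 0 Γ)))))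
            ∂(multivariateGaussian 0 Γ))) +
        ((∫ ω : EuclideanSpace ℝ ι, exp (-U (ω + ψ₀)) ∂(multivariateGaussian 0 Γ))⁻¹ * (∫ ω : EuclideanSpace ℝ ι, exp (-U (ω + ψ₀)) * ((p (ω + ψ₀) -
            ((∫ ω : EuclideanSpace ℝ ι, exp (-U (ω + ψ₀)) ∂(multivariateGaussian 0 Γ))⁻¹ * (∫ ω : EuclideanSpace ℝ ι, exp (-U (ω + ψ₀)) * p (ω + ψ₀)
            ∂(multivariateGaussian 0 Γ)))) * (q (ω + ψ₀) - ((∫ ω : EuclideanSpace ℝ ι, exp (-U (ω + ψ₀)) ∂(multivariateGaussian 0 Γ))⁻¹ * (∫ ω :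
            EuclideanSpace ℝ ι, exp (-U (ω + ψ₀)) * q (ω + ψ₀) ∂(multivariateGaussian 0 Γ)))) * (r' (ω + ψ₀) n - ((∫ ω : EuclideanSpace ℝ ι, exp (-U
            (ω + ψ₀)) ∂(multivariateGaussian 0 Γ))⁻¹ * (∫ ω : EuclideanSpace ℝ ι, exp (-U (ω + ψ₀)) * r' (ω + ψ₀) n ∂(multivariateGaussian 0 Γ)))))
            ∂(multivariateGaussian 0 Γ))) -
        (((∫ ω : EuclideanSpace ℝ ι, exp (-U (ω + ψ₀)) ∂(multivariateGaussian 0 Γ))⁻¹ * (∫ ω : EuclideanSpace ℝ ι, exp (-U (ω + ψ₀)) * ((p (ω + ψ₀) -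
            ((∫ ω : EuclideanSpace ℝ ι, exp (-U (ω + ψ₀)) ∂(multivariateGaussian 0 Γ))⁻¹ * (∫ ω : EuclideanSpace ℝ ι, exp (-U (ω + ψ₀)) * p (ω + ψ₀)
            ∂(multivariateGaussian 0 Γ)))) * (q (ω + ψ₀) - ((∫ ω : EuclideanSpace ℝ ι, exp (-U (ω + ψ₀)) ∂(multivariateGaussian 0 Γ))⁻¹ * (∫ ω :
            EuclideanSpace ℝ ι, exp (-U (ω + ψ₀)) * q (ω + ψ₀) ∂(multivariateGaussian 0 Γ)))) * (r (ω + ψ₀) - ((∫ ω : EuclideanSpace ℝ ι, exp (-U (ω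
            + ψ₀)) ∂(multivariateGaussian 0 Γ))⁻¹ * (∫ ω : EuclideanSpace ℝ ι, exp (-U (ω + ψ₀)) * r (ω + ψ₀) ∂(multivariateGaussian 0 Γ)))) * (U' (ω
            + ψ₀) n - ((∫ ω : EuclideanSpace ℝ ι, exp (-U (ω + ψ₀)) ∂(multivariateGaussian 0 Γ))⁻¹ * (∫ ω : EuclideanSpace ℝ ι, exp (-U (ω + ψ₀)) *
            U' (ω + ψ₀) n ∂(multivariateGaussian 0 Γ))))) ∂(multivariateGaussian 0 Γ))) - ((∫ ω : EuclideanSpace ℝ ι, exp (-U (ω + ψ₀))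
            ∂(multivariateGaussian 0 Γ))⁻¹ * (∫ ω : EuclideanSpace ℝ ι, exp (-U (ω + ψ₀)) * ((p (ω + ψ₀) - ((∫ ω : EuclideanSpace ℝ ι, exp (-U (ω +
            ψ₀)) ∂(multivariateGaussian 0 Γ))⁻¹ * (∫ ω : EuclideanSpace ℝ ι, exp (-U (ω + ψ₀)) * p (ω + ψ₀) ∂(multivariateGaussian 0 Γ)))) * (q (ω +
            ψ₀) - ((∫ ω : EuclideanSpace ℝ ι, exp (-U (ω + ψ₀)) ∂(multivariateGaussian 0 Γ))⁻¹ * (∫ ω : EuclideanSpace ℝ ι, exp (-U (ω + ψ₀)) * q (ω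
            + ψ₀) ∂(multivariateGaussian 0 Γ))))) ∂(multivariateGaussian 0 Γ))) * ((∫ ω : EuclideanSpace ℝ ι, exp (-U (ω + ψ₀))
            ∂(multivariateGaussian 0 Γ))⁻¹ * (∫ ω : EuclideanSpace ℝ ι, exp (-U (ω + ψ₀)) * ((r (ω + ψ₀) - ((∫ ω : EuclideanSpace ℝ ι, exp (-U (ω +
            ψ₀)) ∂(multivariateGaussian 0 Γ))⁻¹ * (∫ ω : EuclideanSpace ℝ ι, exp (-U (ω + ψ₀)) * r (ω + ψ₀) ∂(multivariateGaussian 0 Γ)))) * (U' (ω +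
            ψ₀) n - ((∫ ω : EuclideanSpace ℝ ι, exp (-U (ω + ψ₀)) ∂(multivariateGaussian 0 Γ))⁻¹ * (∫ ω : EuclideanSpace ℝ ι, exp (-U (ω + ψ₀)) * U'
            (ω + ψ₀) n ∂(multivariateGaussian 0 Γ))))) ∂(multivariateGaussian 0 Γ))) - ((∫ ω : EuclideanSpace ℝ ι, exp (-U (ω + ψ₀))
            ∂(multivariateGaussian 0 Γ))⁻¹ * (∫ ω : EuclideanSpace ℝ ι, exp (-U (ω + ψ₀)) * ((p (ω + ψ₀) - ((∫ ω : EuclideanSpace ℝ ι, exp (-U (ω +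
            ψ₀)) ∂(multivariateGaussian 0 Γ))⁻¹ * (∫ ω : EuclideanSpace ℝ ι, exp (-U (ω + ψ₀)) * p (ω + ψ₀) ∂(multivariateGaussian 0 Γ)))) * (r (ω +
            ψ₀) - ((∫ ω : EuclideanSpace ℝ ι, exp (-U (ω + ψ₀)) ∂(multivariateGaussian 0 Γ))⁻¹ * (∫ ω : EuclideanSpace ℝ ι, exp (-U (ω + ψ₀)) * r (ω
            + ψ₀) ∂(multivariateGaussian 0 Γ))))) ∂(multivariateGaussian 0 Γ))) * ((∫ ω : EuclideanSpace ℝ ι, exp (-U (ω + ψ₀))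
            ∂(multivariateGaussian 0 Γ))⁻¹ * (∫ ω : EuclideanSpace ℝ ι, exp (-U (ω + ψ₀)) * ((q (ω + ψ₀) - ((∫ ω : EuclideanSpace ℝ ι, exp (-U (ω +
            ψ₀)) ∂(multivariateGaussian 0 Γ))⁻¹ * (∫ ω : EuclideanSpace ℝ ι, exp (-U (ω + ψ₀)) * q (ω + ψ₀) ∂(multivariateGaussian 0 Γ)))) * (U' (ω +
            ψ₀) n - ((∫ ω : EuclideanSpace ℝ ι, exp (-U (ω + ψ₀)) ∂(multivariateGaussian 0 Γ))⁻¹ * (∫ ω : EuclideanSpace ℝ ι, exp (-U (ω + ψ₀)) * U'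
            (ω + ψ₀) n ∂(multivariateGaussian 0 Γ))))) ∂(multivariateGaussian 0 Γ))) - ((∫ ω : EuclideanSpace ℝ ι, exp (-U (ω + ψ₀))
            ∂(multivariateGaussian 0 Γ))⁻¹ * (∫ ω : EuclideanSpace ℝ ι, exp (-U (ω + ψ₀)) * ((p (ω + ψ₀) - ((∫ ω : EuclideanSpace ℝ ι, exp (-U (ω +
            ψ₀)) ∂(multivariateGaussian 0 Γ))⁻¹ * (∫ ω : EuclideanSpace ℝ ι, exp (-U (ω + ψ₀)) * p (ω + ψ₀) ∂(multivariateGaussian 0 Γ)))) * (U' (ω +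
            ψ₀) n - ((∫ ω : EuclideanSpace ℝ ι, exp (-U (ω + ψ₀)) ∂(multivariateGaussian 0 Γ))⁻¹ * (∫ ω : EuclideanSpace ℝ ι, exp (-U (ω + ψ₀)) * U'
            (ω + ψ₀) n ∂(multivariateGaussian 0 Γ))))) ∂(multivariateGaussian 0 Γ))) * ((∫ ω : EuclideanSpace ℝ ι, exp (-U (ω + ψ₀))
            ∂(multivariateGaussian 0 Γ))⁻¹ * (∫ ω : EuclideanSpace ℝ ι, exp (-U (ω + ψ₀)) * ((q (ω + ψ₀) - ((∫ ω : EuclideanSpace ℝ ι, exp (-U (ω +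
            ψ₀)) ∂(multivariateGaussian 0 Γ))⁻¹ * (∫ ω : EuclideanSpace ℝ ι, exp (-U (ω + ψ₀)) * q (ω + ψ₀) ∂(multivariateGaussian 0 Γ)))) * (r (ω +
            ψ₀) - ((∫ ω : EuclideanSpace ℝ ι, exp (-U (ω + ψ₀)) ∂(multivariateGaussian 0 Γ))⁻¹ * (∫ ω : EuclideanSpace ℝ ι, exp (-U (ω + ψ₀)) * r (ω
            + ψ₀) ∂(multivariateGaussian 0 Γ))))) ∂(multivariateGaussian 0 Γ))))) 0 := by
  have hU'c : Continuous U' := continuous_iff_continuousAt.2 fun φ => (hU'd φ).continuousAt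
  have hpc : Continuous p := continuous_iff_continuousAt.2 fun φ => (hp φ).continuousAt
  have hqc : Continuous q := continuous_iff_continuousAt.2 fun φ => (hq φ).continuousAt
  have hrc : Continuous r := continuous_iff_continuousAt.2 fun φ => (hr φ).continuousAt
  have hκ₂ : 0 ≤ κ₂ := (norm_nonneg (U'' ψ₀)).trans (hU''b ψ₀)
  have hZpos : ∀ ψ : EuclideanSpace ℝ ι, 0 < (∫ ω : EuclideanSpace ℝ ι, exp (-U (ω + ψ)) ∂(multivariateGaussian 0 Γ)) := fun ψ =>
    block_Z_pos hΓ hΓop Y hUd hκ₀ hτ hδ hθ0 hθ1 hκθ hstab ψ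
  have hAb : ∀ φ : EuclideanSpace ℝ ι, |U' φ n| ≤ ‖n‖ * (1 + κ₂) * (1 + ‖U' φ‖) ^ 1 := fun φ => class_grad_abs_le hκ₂ φ n
  have hAc : Continuous fun φ : EuclideanSpace ℝ ι => U' φ n := hU'c.clm_apply continuous_const
  -- Step 1: the centred function IS the raw third cumulant at every `s`
  have hfun : (fun s : ℝ => ((∫ ω : EuclideanSpace ℝ ι, exp (-U (ω + (ψ₀ + s • n))) ∂(multivariateGaussian 0 Γ))⁻¹ * (∫ ω : EuclideanSpace ℝ ι, exp
      (-U (ω + (ψ₀ + s • n))) * ((p (ω + (ψ₀ + s • n)) - ((∫ ω : EuclideanSpace ℝ ι, exp (-U (ω + (ψ₀ + s • n))) ∂(multivariateGaussian 0 Γ))⁻¹ * (∫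
      ω : EuclideanSpace ℝ ι, exp (-U (ω + (ψ₀ + s • n))) * p (ω + (ψ₀ + s • n)) ∂(multivariateGaussian 0 Γ)))) * (q (ω + (ψ₀ + s • n)) - ((∫ ω :
      EuclideanSpace ℝ ι, exp (-U (ω + (ψ₀ + s • n))) ∂(multivariateGaussian 0 Γ))⁻¹ * (∫ ω : EuclideanSpace ℝ ι, exp (-U (ω + (ψ₀ + s • n))) * q (ω
      + (ψ₀ + s • n)) ∂(multivariateGaussian 0 Γ)))) * (r (ω + (ψ₀ + s • n)) - ((∫ ω : EuclideanSpace ℝ ι, exp (-U (ω + (ψ₀ + s • n)))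
      ∂(multivariateGaussian 0 Γ))⁻¹ * (∫ ω : EuclideanSpace ℝ ι, exp (-U (ω + (ψ₀ + s • n))) * r (ω + (ψ₀ + s • n)) ∂(multivariateGaussian 0 Γ)))))
      ∂(multivariateGaussian 0 Γ)))) =
      fun s : ℝ => (∫ ω : EuclideanSpace ℝ ι, exp (-U (ω + (ψ₀ + s • n))) ∂(multivariateGaussian 0 Γ))⁻¹ * (∫ ω : EuclideanSpace ℝ ι, exp (-U (ω +
          (ψ₀ + s • n))) * (p (ω + (ψ₀ + s • n)) * q (ω + (ψ₀ + s • n)) * r (ω + (ψ₀ + s • n))) ∂(multivariateGaussian 0 Γ)) -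
        ((∫ ω : EuclideanSpace ℝ ι, exp (-U (ω + (ψ₀ + s • n))) ∂(multivariateGaussian 0 Γ)) ^ 2)⁻¹ * ((∫ ω : EuclideanSpace ℝ ι, exp (-U (ω + (ψ₀ +
            s • n))) * p (ω + (ψ₀ + s • n)) ∂(multivariateGaussian 0 Γ)) * (∫ ω : EuclideanSpace ℝ ι, exp (-U (ω + (ψ₀ + s • n))) * (q (ω + (ψ₀ + s •
            n)) * r (ω + (ψ₀ + s • n))) ∂(multivariateGaussian 0 Γ)) +
          ((∫ ω : EuclideanSpace ℝ ι, exp (-U (ω + (ψ₀ + s • n))) * q (ω + (ψ₀ + s • n)) ∂(multivariateGaussian 0 Γ)) * (∫ ω : EuclideanSpace ℝ ι,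
              exp (-U (ω + (ψ₀ + s • n))) * (p (ω + (ψ₀ + s • n)) * r (ω + (ψ₀ + s • n))) ∂(multivariateGaussian 0 Γ)) +
          (∫ ω : EuclideanSpace ℝ ι, exp (-U (ω + (ψ₀ + s • n))) * r (ω + (ψ₀ + s • n)) ∂(multivariateGaussian 0 Γ)) * (∫ ω : EuclideanSpace ℝ ι, exp
              (-U (ω + (ψ₀ + s • n))) * (p (ω + (ψ₀ + s • n)) * q (ω + (ψ₀ + s • n))) ∂(multivariateGaussian 0 Γ)))) +
        2 * (((∫ ω : EuclideanSpace ℝ ι, exp (-U (ω + (ψ₀ + s • n))) ∂(multivariateGaussian 0 Γ)) ^ 3)⁻¹ * ((∫ ω : EuclideanSpace ℝ ι, exp (-U (ω +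
            (ψ₀ + s • n))) * p (ω + (ψ₀ + s • n)) ∂(multivariateGaussian 0 Γ)) * (∫ ω : EuclideanSpace ℝ ι, exp (-U (ω + (ψ₀ + s • n))) * q (ω + (ψ₀
            + s • n)) ∂(multivariateGaussian 0 Γ)) * (∫ ω : EuclideanSpace ℝ ι, exp (-U (ω + (ψ₀ + s • n))) * r (ω + (ψ₀ + s • n))
            ∂(multivariateGaussian 0 Γ)))) := by
    funext s
    rw [split_centred_triple (f := p) (g := q) (h := r) hΓ hΓop Y hUd hκ₀ hκ₁ ha hτ hδ hθ1 hκθ hstab hU'b hpc hqc hrc hpb hqb hrb (ψ₀ + s • n)]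
    have hz := ne_of_gt (hZpos (ψ₀ + s • n))
    field_simp
    ring
  rw [hfun]
  -- Step 2: the eight moment line derivatives
  have hZ := hasDerivAt_Z_line hΓ hΓop Y hUd hU'd hκ₀ hκ₁ ha hτ hδ hθ1 hκθ hstab hU'b hU''b ψ₀ n
  have hMp := hasDerivAt_moment_line hΓ hΓop Y hUd hU'd hκ₀ hκ₁ ha hτ hδ hθ1 hκθ hstab hU'b hU''b hp hp'c hpb hp'b ψ₀ n
  have hMq := hasDerivAt_moment_line hΓ hΓop Y hUd hU'd hκ₀ hκ₁ ha hτ hδ hθ1 hκθ hstab hU'b hU''b hq hq'c hqb hq'b ψ₀ n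
  have hMr := hasDerivAt_moment_line hΓ hΓop Y hUd hU'd hκ₀ hκ₁ ha hτ hδ hθ1 hκθ hstab hU'b hU''b hr hr'c hrb hr'b ψ₀ n
  have hMpq := hasDerivAt_moment_line (p := fun φ => p φ * q φ) (p' := fun φ => p φ • q' φ + q φ • p' φ) (Cp := 2 * Cp * Cq) (np := np + nq)
    hΓ hΓop Y hUd hU'd hκ₀ hκ₁ ha hτ hδ hθ1 hκθ hstab hU'b hU''b (fun φ => (hp φ).mul (hq φ)) (class_mul_fderiv_continuous hp hp'c hq hq'c) (fun φ =>
        class_mul_abs_le hpb hqb φ)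
    (fun φ => class_mul_fderiv_le hpb hp'b hqb hq'b φ) ψ₀ n
  have hMpr := hasDerivAt_moment_line (p := fun φ => p φ * r φ) (p' := fun φ => p φ • r' φ + r φ • p' φ) (Cp := 2 * Cp * Cr) (np := np + nr)
    hΓ hΓop Y hUd hU'd hκ₀ hκ₁ ha hτ hδ hθ1 hκθ hstab hU'b hU''b (fun φ => (hp φ).mul (hr φ)) (class_mul_fderiv_continuous hp hp'c hr hr'c) (fun φ =>
        class_mul_abs_le hpb hrb φ)
    (fun φ => class_mul_fderiv_le hpb hp'b hrb hr'b φ) ψ₀ n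
  have hMqr := hasDerivAt_moment_line (p := fun φ => q φ * r φ) (p' := fun φ => q φ • r' φ + r φ • q' φ) (Cp := 2 * Cq * Cr) (np := nq + nr)
    hΓ hΓop Y hUd hU'd hκ₀ hκ₁ ha hτ hδ hθ1 hκθ hstab hU'b hU''b (fun φ => (hq φ).mul (hr φ)) (class_mul_fderiv_continuous hq hq'c hr hr'c) (fun φ =>
        class_mul_abs_le hqb hrb φ)
    (fun φ => class_mul_fderiv_le hqb hq'b hrb hr'b φ) ψ₀ n
  have hMpqr := hasDerivAt_moment_line (p := fun φ => p φ * q φ * r φ) (p' := fun φ => (p φ * q φ) • r' φ + r φ • (p φ • q' φ + q φ • p' φ))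
    (Cp := 2 * (2 * Cp * Cq) * Cr) (np := np + nq + nr) hΓ hΓop Y hUd hU'd hκ₀ hκ₁ ha hτ hδ hθ1 hκθ hstab hU'b hU''b (fun φ => ((hp φ).mul (hq
        φ)).mul (hr φ))
    (((hpc.mul hqc).smul hr'c).add (hrc.smul (class_mul_fderiv_continuous hp hp'c hq hq'c)))
    (fun φ => class_mul_abs_le (fun φ => class_mul_abs_le hpb hqb φ) hrb φ)
    (fun φ => class_mul_fderiv_le (p := fun φ => p φ * q φ) (p' := fun φ => p φ • q' φ + q φ • p' φ) (fun φ => class_mul_abs_le hpb hqb φ)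
      (fun φ => class_mul_fderiv_le hpb hp'b hqb hq'b φ) hrb hr'b φ) ψ₀ n
  -- Step 3: split the applied derivative observables into raw moments
  have ipq' := integrable_tilted_of_growth (p := fun φ => p φ * q' φ n) hΓ hΓop Y hUd (hpc.mul (hq'c.clm_apply continuous_const)) hκ₀ hκ₁ ha hτ hδ
      hθ1 hκθ hstab hU'b
    (fun φ => class_mul_abs_le hpb (fun φ => class_apply_abs_le hq'b φ n) φ) ψ₀
  have ip'q := integrable_tilted_of_growth (p := fun φ => p' φ n * q φ) hΓ hΓop Y hUd ((hp'c.clm_apply continuous_const).mul hqc) hκ₀ hκ₁ ha hτ hδ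
      hθ1 hκθ hstab hU'b
    (fun φ => class_mul_abs_le (fun φ => class_apply_abs_le hp'b φ n) hqb φ) ψ₀
  have ipr' := integrable_tilted_of_growth (p := fun φ => p φ * r' φ n) hΓ hΓop Y hUd (hpc.mul (hr'c.clm_apply continuous_const)) hκ₀ hκ₁ ha hτ hδ
      hθ1 hκθ hstab hU'b
    (fun φ => class_mul_abs_le hpb (fun φ => class_apply_abs_le hr'b φ n) φ) ψ₀
  have ip'r := integrable_tilted_of_growth (p := fun φ => p' φ n * r φ) hΓ hΓop Y hUd ((hp'c.clm_apply continuous_const).mul hrc) hκ₀ hκ₁ ha hτ hδ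
      hθ1 hκθ hstab hU'b
    (fun φ => class_mul_abs_le (fun φ => class_apply_abs_le hp'b φ n) hrb φ) ψ₀
  have iqr' := integrable_tilted_of_growth (p := fun φ => q φ * r' φ n) hΓ hΓop Y hUd (hqc.mul (hr'c.clm_apply continuous_const)) hκ₀ hκ₁ ha hτ hδ
      hθ1 hκθ hstab hU'b
    (fun φ => class_mul_abs_le hqb (fun φ => class_apply_abs_le hr'b φ n) φ) ψ₀
  have iq'r := integrable_tilted_of_growth (p := fun φ => q' φ n * r φ) hΓ hΓop Y hUd ((hq'c.clm_apply continuous_const).mul hrc) hκ₀ hκ₁ ha hτ hδ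
      hθ1 hκθ hstab hU'b
    (fun φ => class_mul_abs_le (fun φ => class_apply_abs_le hq'b φ n) hrb φ) ψ₀
  have ipqr' := integrable_tilted_of_growth (p := fun φ => p φ * q φ * r' φ n) hΓ hΓop Y hUd ((hpc.mul hqc).mul (hr'c.clm_apply continuous_const))
      hκ₀ hκ₁ ha hτ hδ hθ1 hκθ hstab hU'b
    (fun φ => class_mul_abs_le (fun φ => class_mul_abs_le hpb hqb φ) (fun φ => class_apply_abs_le hr'b φ n) φ) ψ₀
  have ipq'r := integrable_tilted_of_growth (p := fun φ => p φ * q' φ n * r φ) hΓ hΓop Y hUd ((hpc.mul (hq'c.clm_apply continuous_const)).mul hrc)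
      hκ₀ hκ₁ ha hτ hδ hθ1 hκθ hstab hU'b
    (fun φ => class_mul_abs_le (fun φ => class_mul_abs_le hpb (fun φ => class_apply_abs_le hq'b φ n) φ) hrb φ) ψ₀
  have ip'qr := integrable_tilted_of_growth (p := fun φ => p' φ n * q φ * r φ) hΓ hΓop Y hUd (((hp'c.clm_apply continuous_const).mul hqc).mul hrc)
      hκ₀ hκ₁ ha hτ hδ hθ1 hκθ hstab hU'b
    (fun φ => class_mul_abs_le (fun φ => class_mul_abs_le (fun φ => class_apply_abs_le hp'b φ n) hqb φ) hrb φ) ψ₀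
  have epq : (∫ ω : EuclideanSpace ℝ ι, exp (-U (ω + ψ₀)) * (p (ω + ψ₀) • q' (ω + ψ₀) + q (ω + ψ₀) • p' (ω + ψ₀)) n ∂(multivariateGaussian 0 Γ)) =
      (∫ ω : EuclideanSpace ℝ ι, exp (-U (ω + ψ₀)) * (p (ω + ψ₀) * q' (ω + ψ₀) n) ∂(multivariateGaussian 0 Γ)) + (∫ ω : EuclideanSpace ℝ ι, exp (-U
          (ω + ψ₀)) * (p' (ω + ψ₀) n * q (ω + ψ₀)) ∂(multivariateGaussian 0 Γ)) := by
    rw [← integral_add ipq' ip'q]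
    exact integral_congr_ae (ae_of_all _ fun ω => by simp only [_root_.add_apply, _root_.smul_apply, smul_eq_mul]; ring)
  have epr : (∫ ω : EuclideanSpace ℝ ι, exp (-U (ω + ψ₀)) * (p (ω + ψ₀) • r' (ω + ψ₀) + r (ω + ψ₀) • p' (ω + ψ₀)) n ∂(multivariateGaussian 0 Γ)) =
      (∫ ω : EuclideanSpace ℝ ι, exp (-U (ω + ψ₀)) * (p (ω + ψ₀) * r' (ω + ψ₀) n) ∂(multivariateGaussian 0 Γ)) + (∫ ω : EuclideanSpace ℝ ι, exp (-U
          (ω + ψ₀)) * (p' (ω + ψ₀) n * r (ω + ψ₀)) ∂(multivariateGaussian 0 Γ)) := by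
    rw [← integral_add ipr' ip'r]
    exact integral_congr_ae (ae_of_all _ fun ω => by simp only [_root_.add_apply, _root_.smul_apply, smul_eq_mul]; ring)
  have eqr : (∫ ω : EuclideanSpace ℝ ι, exp (-U (ω + ψ₀)) * (q (ω + ψ₀) • r' (ω + ψ₀) + r (ω + ψ₀) • q' (ω + ψ₀)) n ∂(multivariateGaussian 0 Γ)) =
      (∫ ω : EuclideanSpace ℝ ι, exp (-U (ω + ψ₀)) * (q (ω + ψ₀) * r' (ω + ψ₀) n) ∂(multivariateGaussian 0 Γ)) + (∫ ω : EuclideanSpace ℝ ι, exp (-U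
          (ω + ψ₀)) * (q' (ω + ψ₀) n * r (ω + ψ₀)) ∂(multivariateGaussian 0 Γ)) := by
    rw [← integral_add iqr' iq'r]
    exact integral_congr_ae (ae_of_all _ fun ω => by simp only [_root_.add_apply, _root_.smul_apply, smul_eq_mul]; ring)
  have i23 : Integrable (fun ω : EuclideanSpace ℝ ι => exp (-U (ω + ψ₀)) * (p (ω + ψ₀) * q' (ω + ψ₀) n * r (ω + ψ₀)) + exp (-U (ω + ψ₀)) * (p' (ω +
      ψ₀) n * q (ω + ψ₀) * r (ω + ψ₀)))
      (multivariateGaussian 0 Γ) := ipq'r.add ip'qr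
  have epqr : (∫ ω : EuclideanSpace ℝ ι, exp (-U (ω + ψ₀)) * ((p (ω + ψ₀) * q (ω + ψ₀)) • r' (ω + ψ₀) + r (ω + ψ₀) • (p (ω + ψ₀) • q' (ω + ψ₀) + q (ω
      + ψ₀) • p' (ω + ψ₀))) n ∂(multivariateGaussian 0 Γ)) =
      (∫ ω : EuclideanSpace ℝ ι, exp (-U (ω + ψ₀)) * (p (ω + ψ₀) * q (ω + ψ₀) * r' (ω + ψ₀) n) ∂(multivariateGaussian 0 Γ)) + ((∫ ω : EuclideanSpace
          ℝ ι, exp (-U (ω + ψ₀)) * (p (ω + ψ₀) * q' (ω + ψ₀) n * r (ω + ψ₀)) ∂(multivariateGaussian 0 Γ)) + (∫ ω : EuclideanSpace ℝ ι, exp (-U (ω +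
          ψ₀)) * (p' (ω + ψ₀) n * q (ω + ψ₀) * r (ω + ψ₀)) ∂(multivariateGaussian 0 Γ))) := by
    rw [← integral_add ipq'r ip'qr, ← integral_add ipqr' i23]
    exact integral_congr_ae (ae_of_all _ fun ω => by simp only [_root_.add_apply, _root_.smul_apply, smul_eq_mul]; ring)
  rw [epq] at hMpq
  rw [epr] at hMpr
  rw [eqr] at hMqr
  rw [epqr] at hMpqr
  -- Step 4: split the centred target
  rw [split_centred_triple (f := fun φ => p' φ n) (g := q) (h := r) hΓ hΓop Y hUd hκ₀ hκ₁ ha hτ hδ hθ1 hκθ hstab hU'b (hp'c.clm_apply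
      continuous_const)
      hqc hrc (fun φ => class_apply_abs_le hp'b φ n) hqb hrb ψ₀,
    split_centred_triple (f := p) (g := fun φ => q' φ n) (h := r) hΓ hΓop Y hUd hκ₀ hκ₁ ha hτ hδ hθ1 hκθ hstab hU'b hpc (hq'c.clm_apply
        continuous_const)
      hrc hpb (fun φ => class_apply_abs_le hq'b φ n) hrb ψ₀,
    split_centred_triple (f := p) (g := q) (h := fun φ => r' φ n) hΓ hΓop Y hUd hκ₀ hκ₁ ha hτ hδ hθ1 hκθ hstab hU'b hpc hqc (hr'c.clm_apply
        continuous_const)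
      hpb hqb (fun φ => class_apply_abs_le hr'b φ n) ψ₀,
    split_centred_quad (f := p) (g := q) (h := r) (w := fun φ => U' φ n) hΓ hΓop Y hUd hκ₀ hκ₁ ha hτ hδ hθ1 hκθ hstab hU'b hpc hpb hqc hqb hrc hrb hAc
      hAb ψ₀,
    split_centred_pair (f := p) (g := q) hΓ hΓop Y hUd hκ₀ hκ₁ ha hτ hδ hθ1 hκθ hstab hU'b hpc hpb hqc hqb ψ₀,
    split_centred_pair (f := r) (g := fun φ => U' φ n) hΓ hΓop Y hUd hκ₀ hκ₁ ha hτ hδ hθ1 hκθ hstab hU'b hrc hrb hAc hAb ψ₀,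
    split_centred_pair (f := p) (g := r) hΓ hΓop Y hUd hκ₀ hκ₁ ha hτ hδ hθ1 hκθ hstab hU'b hpc hpb hrc hrb ψ₀,
    split_centred_pair (f := q) (g := fun φ => U' φ n) hΓ hΓop Y hUd hκ₀ hκ₁ ha hτ hδ hθ1 hκθ hstab hU'b hqc hqb hAc hAb ψ₀,
    split_centred_pair (f := p) (g := fun φ => U' φ n) hΓ hΓop Y hUd hκ₀ hκ₁ ha hτ hδ hθ1 hκθ hstab hU'b hpc hpb hAc hAb ψ₀,
    split_centred_pair (f := q) (g := r) hΓ hΓop Y hUd hκ₀ hκ₁ ha hτ hδ hθ1 hκθ hstab hU'b hqc hqb hrc hrb ψ₀]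
  -- Step 5: combine the derivatives and close by field algebra
  have hz0 : (fun s : ℝ => ∫ ω : EuclideanSpace ℝ ι, exp (-U (ω + (ψ₀ + s • n))) ∂(multivariateGaussian 0 Γ)) 0 ≠ 0 := by
    simp only [zero_smul, add_zero]; exact ne_of_gt (hZpos ψ₀)
  have hz2 : (fun s : ℝ => (∫ ω : EuclideanSpace ℝ ι, exp (-U (ω + (ψ₀ + s • n))) ∂(multivariateGaussian 0 Γ)) ^ 2) 0 ≠ 0 := by
    simp only [zero_smul, add_zero]; exact pow_ne_zero 2 (ne_of_gt (hZpos ψ₀))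
  have hz3 : (fun s : ℝ => (∫ ω : EuclideanSpace ℝ ι, exp (-U (ω + (ψ₀ + s • n))) ∂(multivariateGaussian 0 Γ)) ^ 3) 0 ≠ 0 := by
    simp only [zero_smul, add_zero]; exact pow_ne_zero 3 (ne_of_gt (hZpos ψ₀))
  have h := (((hZ.inv hz0).mul hMpqr).sub (((hZ.pow 2).inv hz2).mul ((hMp.mul hMqr).add ((hMq.mul hMpr).add (hMr.mul hMpq))))).add
    ((((hZ.pow 3).inv hz3).mul ((hMp.mul hMq).mul hMr)).const_mul 2)
  simp only [Pi.inv_apply, Pi.mul_apply, Pi.pow_apply, Pi.add_apply, zero_smul, add_zero] at h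
  have hZ0 := ne_of_gt (hZpos ψ₀)
  refine h.congr_deriv ?_
  field_simp
  ring

/-! ## Toy -/

/-- Toy (three ways to pair the derivative with the vertices): `1 + 1 + 1 = 3`. -/
example : (1 : ℕ) + 1 + 1 = 3 := by norm_num

end Summit.QuantumFields.BalabanUV.T4Continuum.NE7b.SupTiltedCumulantCalculusTwo

end
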